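import Mathlib
import Summits.Ventures.PercRepro2.Defs
import Summits.Ventures.PercRepro2.Independence
import Summits.Ventures.PercRepro2.Harris
import Summits.Ventures.PercRepro2.Graph
import Summits.Ventures.PercRepro2.Exploration
import Summits.Ventures.PercRepro2.Events
import Summits.Ventures.PercRepro2.FourFunctions
import Summits.Ventures.PercRepro2.Induced
import Summits.Ventures.PercRepro2.Frontier
import Summits.Ventures.PercRepro2.ObsIndependence
import Summits.Ventures.PercRepro2.BHK
import Summits.Ventures.PercRepro2.BHKEvents
import Summits.Ventures.PercRepro2.SideAgreement
import Summits.Ventures.PercRepro2.VdBKahn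
import Summits.Ventures.PercRepro2.BHKAvoid
import Summits.Ventures.PercRepro2.R2PrimeThreeReduction
import Summits.Ventures.PercRepro2.YBridge
import Summits.Ventures.PercRepro2.Yu1Functionals
import Summits.Ventures.PercRepro2.Yu1Events
import Summits.Ventures.PercRepro2.Yu1
import Summits.Ventures.PercRepro2.LBSplit
import Summits.Ventures.PercRepro2.YDelta
import Summits.Ventures.PercRepro2.SD
import Summits.Ventures.PercRepro2.Threshold
import Summits.Ventures.PercRepro2.Lambda
import Summits.Ventures.PercRepro2.LambdaTau
import Summits.Ventures.PercRepro2.LambdaSlack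
import Summits.Ventures.PercRepro2.HF2
import Summits.Ventures.PercRepro2.Yu2
import Summits.Ventures.PercRepro2.N0
import Summits.Ventures.PercRepro2.Y
import Summits.Ventures.PercRepro2.YDeltaTools
import Summits.Ventures.PercRepro2.ZDelta
import Summits.Ventures.PercRepro2.ZExpand
import Summits.Ventures.PercRepro2.ISplit
import Summits.Ventures.PercRepro2.MRl
import Summits.Ventures.PercRepro2.ZOloc
import Summits.Ventures.PercRepro2.SideBridge
import Summits.Ventures.PercRepro2.HCov
import Summits.Ventures.PercRepro2.HullDefs
import Summits.Ventures.PercRepro2.HullFlip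
import Summits.Ventures.PercRepro2.HullTheoremA

/-!
# Rows 2′PEND, (LOC-𝓤) and (LOC0) as definitions (blind cell PercRepro2, typer-1; lead g11
ASSIGNMENTS v11.9 (3) and v11.10 (5); engine 09:43:44Z, mine-2 g9 M2-14 / 10:07:12Z)

* **2′PEND** (`Pend`): for `a₃` a leaf attached by the edge `f` of weight `q`,
  `G ≥ (1 − q) · G₀` with `G₀` the `a₃`-free functional (`= G` at `q = 0`, where `D = P(Q)`), in the
  cleared form `(1 − q) · D · Gc(p[f ↦ 0]) ≤ Gc(p) · P(Q)²` (equivalent to the ratio form when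
  `D · P(Q) > 0`); closure `Pend_all` over every leaf attachment. Engine: 0 violations / 86,700
  pendant instances at `n = 6` FULL (17 vectors) and 0 / 24,120 at `n = 7`. `PendantRoot` /
  `PendantO` give `Gc` at root and `o` attachments in closed form.
* **(LOC-𝓤)** (`LocU`): on the free fibre, an injection from `{h ∉ H_l, C_B(l) ∈ 𝓤, C_R(l) ∉ 𝓤}`
  into `{h ∉ H_l, C_R(l) ∈ 𝓤, C_B(l) ∉ 𝓤}` that recolours only edges touching `C_B(l)` of the
  source configuration; **(LOC0)** (`Loc0`): the `b`-free principal case `𝓤 = {S ∣ o ∈ S}`, with the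
  stronger locality "only edges touching the piece of `o`" (mine-2's `P_o`-local injection,
  0 failures through `n = 7, m ≤ 10`). Definitions only (`card_le_of_loc0`: the counting
  consequence `|M₀| ≤ |P₀|`).
-/

namespace Summit.Ventures.PercRepro2

open UnionCluster CovForm

namespace LocRows

variable {V : Type*} {E : Type*} [Fintype E] [DecidableEq E] {R : Type*} [Field R]
  [LinearOrder R] [IsStrictOrderedRing R]

/-! ## 2′PEND -/

section Pend

variable (p : E → R) (ends : E → Sym2 V)

/-- **Row 2′PEND** (cleared): `(1 − q) · D · Gc(p[f ↦ 0]) ≤ Gc(p) · P(Q)²`, i.e.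
`G ≥ (1 − q) · G₀` whenever `D · P(Q) > 0`. -/
def Pend (f : E) (o a₁ a₂ a₃ b : V) : Prop :=
  (1 - p f) * prob p (PDEvent ends a₁ a₂ a₃) * Gc (Function.update p f 0) ends o a₁ a₂ a₃ b ≤
    Gc p ends o a₁ a₂ a₃ b * prob p (avoidAll ends a₂ {a₁}) ^ 2

end Pend

section PendClosure

variable (R : Type*) [Field R] [LinearOrder R] [IsStrictOrderedRing R]

/-- Row 2′PEND over all finite graphs, admissible weights and markings in which `a₃` is a leaf
(attached anywhere by the single edge `f`). -/
def Pend_all : Prop :=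
  ∀ (V E : Type) [Fintype V] [DecidableEq V] [Fintype E] [DecidableEq E]
    (ends : E → Sym2 V) (p : E → R), IsProbVec p →
    ∀ (f : E) (v o a₁ a₂ a₃ b : V), ends f = s(a₃, v) → (∀ e, a₃ ∈ ends e → e = f) →
      a₁ ≠ a₂ → a₁ ≠ a₃ → a₂ ≠ a₃ → o ≠ a₁ → o ≠ a₂ → o ≠ a₃ → o ≠ b → b ≠ a₁ → b ≠ a₂ → b ≠ a₃ →
      Pend p ends f o a₁ a₂ a₃ b

end PendClosure

/-! ## (LOC-𝓤) and (LOC0) on the free fibre -/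

section Loc

open Hull

open scoped Classical

variable (ends : E → Sym2 V)

/-- `ζ′` recolours only edges touching the vertex set `S ζ` attached to the source `ζ`. -/
def LocalAtSet (S : Config E → Set V) (ζ ζ' : Config E) : Prop :=
  ∀ e, ζ' e ≠ ζ e → e ∈ touches ends (S ζ)

/-- The source side of (LOC-𝓤): `{h ∉ H_l, C_B(l) ∈ 𝓤, C_R(l) ∉ 𝓤}`. -/
noncomputable def srcU (l h : V) (𝓤 : Set (Set V)) : Finset (Config E) :=
  Finset.univ.filter fun ζ =>
    h ∉ hull ends ζ l ∧ cluster ends (blue ζ) l ∈ 𝓤 ∧ cluster ends ζ l ∉ 𝓤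

/-- The target side of (LOC-𝓤): `{h ∉ H_l, C_R(l) ∈ 𝓤, C_B(l) ∉ 𝓤}`. -/
noncomputable def tgtU (l h : V) (𝓤 : Set (Set V)) : Finset (Config E) :=
  Finset.univ.filter fun ζ =>
    h ∉ hull ends ζ l ∧ cluster ends ζ l ∈ 𝓤 ∧ cluster ends (blue ζ) l ∉ 𝓤

/-- **(LOC-𝓤)**: an injection `srcU → tgtU` recolouring only edges touching `C_B(l)` of the source. -/
def LocU (l h : V) (𝓤 : Set (Set V)) : Prop :=
  ∃ f : {ζ // ζ ∈ srcU ends l h 𝓤} → Config E, Function.Injective f ∧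
    ∀ x, f x ∈ tgtU ends l h 𝓤 ∧
      LocalAtSet ends (fun ζ => cluster ends (blue ζ) l) x.1 (f x)

/-- The `b`-free source `M₀ = {h ∉ H_l, o ∈ B_side}`. -/
noncomputable def src0 (l h o : V) : Finset (Config E) :=
  Finset.univ.filter fun ζ => h ∉ hull ends ζ l ∧ o ∈ bside ends ζ l

/-- The `b`-free target `P₀ = {h ∉ H_l, o ∈ R_side}`. -/
noncomputable def tgt0 (l h o : V) : Finset (Config E) :=
  Finset.univ.filter fun ζ => h ∉ hull ends ζ l ∧ o ∈ rside ends ζ l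

/-- **(LOC0)** (mine-2 M2-14, the `P_o`-local `b`-free injection): an injection `M₀ → P₀`
recolouring only edges touching the piece of `o` in the source configuration. -/
def Loc0 (l h o : V) : Prop :=
  ∃ f : {ζ // ζ ∈ src0 ends l h o} → Config E, Function.Injective f ∧
    ∀ x, f x ∈ tgt0 ends l h o ∧ LocalAtSet ends (fun ζ => piece ends ζ l o) x.1 (f x)

/-- The counting consequence of (LOC0): `|M₀| ≤ |P₀|`. -/
theorem card_le_of_loc0 (l h o : V) (hl : Loc0 ends l h o) :
    (src0 ends l h o).card ≤ (tgt0 ends l h o).card := by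
  obtain ⟨f, hf, hmem⟩ := hl
  have key := Finset.card_le_card_of_injOn f
    (s := (Finset.univ : Finset {ζ // ζ ∈ src0 ends l h o})) (t := tgt0 ends l h o)
    (fun x _ => (hmem x).1) (fun x _ y _ hxy => hf hxy)
  rwa [Finset.card_univ, Fintype.card_coe] at key

/-- The counting consequence of (LOC-𝓤): `|srcU| ≤ |tgtU|`. -/
theorem card_le_of_locU (l h : V) (𝓤 : Set (Set V)) (hl : LocU ends l h 𝓤) :
    (srcU ends l h 𝓤).card ≤ (tgtU ends l h 𝓤).card := by
  obtain ⟨f, hf, hmem⟩ := hl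
  have key := Finset.card_le_card_of_injOn f
    (s := (Finset.univ : Finset {ζ // ζ ∈ srcU ends l h 𝓤})) (t := tgtU ends l h 𝓤)
    (fun x _ => (hmem x).1) (fun x _ y _ hxy => hf hxy)
  rwa [Finset.card_univ, Fintype.card_coe] at key

end Loc

end LocRows

end Summit.Ventures.PercRepro2
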